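import Summits.QuantumFields.YangMills.Theorems.UnitScaleTiltHalvingHSiteTorusBlocks
import Literature.MathematicalPhysics.QuantumFieldTheory.Balaban1983to89.B8Prop5ContractionKLevel
import HarnessLib

/-!
# `hP1room` PROGRAMME (LEAD-H «H = hMember ⟸ (K-site) FULL», row «w8-19936: (K-site-Torus-II)»): ★★★ THE TORUS SOCKET `hTorus` OF THE k = 1 COMPOSER
# DISCHARGED FROM WINDOW LETTERS — J3's fine near-`1` on □̃ ⇒ the reads on the territory (chart-free twin of ✓`HalvingHSiteTopReads.topReads_of_datum`),
# then (K-DE) on the territory of ✓`HalvingHSiteTorusBlocks`, then the seven `th`-windows in the «∀ τ ∈ [0, τ₀]» currency of ✓`HalvingHSupURhoWindowsRho3`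

Route `UnitScaleTilt`, crux K1 child «MinimiserStabilityRegPr» (stmt-QuantumFields-19200), registered stub `stub_halvingStep` (`BirthV10`); cell `ym3-torus` (HUMAN RULING
D-0037: YM₃ on T³ is ladder rung R3 — NOT d = 4, NOT a mass gap, NOT the Clay problem), twin-width seat `ym-ust-19936-w8` gen 4.  `--supports stmt-QuantumFields-19200
--as helper`; THEOREMS ONLY (0 `def`, 0 `sorry`); count-neutral; nothing here claims `core′`, `hMember`, `hSupU(ρ3)`, the stub, the crux or the gap.

WHAT.  The k = 1 (K-site) FULL composer ✓`HalvingHSiteBaseDataOfSockets.baseData_of_sockets` (★w7-19200 g5) DISPLAYS one torus socket `hTorus`: for every `SU(2)` gauge `gJ`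
whose pre-gauged field `U′ := pull (U^{gJ})♯ 0` is fine-near-`1` (`< s`) on the tilde cube □̃, and every effective-gauge tower `κf` of the charted iterate
`W₁ := (U♯)^{ĝJ}` (composite gauge at `u₁ := 1`) with F3's recursion∕bottom, the blocks (D)(E)(τ) of the top-step call together with its seven `th`-windows.
THIS FILE inhabits that socket from ∀-uniform window letters only (LEAD-H LETTER RULE 18:39:53Z: nothing of `gJ U′ κf th` displayed):
* §1 ★`topReads_of_near` — the three (K-DE) reads `‖W₁ b − 1‖ ≤ s`, `W₁ b ∈ U(2)`, `det W₁ b = 1` for every fine bond whose window representative lies in N05's top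
  cube `□_k`, from the fine near-`1` of `U′` on □̃ ⊇ □_k ∪ (□_k + e_ν) (lit ✓`B8Eq131Cubes.cube_subset_tcube`, ✓`B8Eq131CubesAdmissible.add_mem_cube_of_mem_succ`) and the
  descent identity ✓`HalvingHSiteTopKnit.gaugeActT_descent_eq_of_mgauge_cube` at `u₁ := 1` (`mgauge 1 1 U′ = U′`); special unitarity by ✓`hg_of_datum` ∕ ✓`su2_toUnits`.
* §2 ★★★`torusPackage_of_reads` — k-GENERIC, ANY torus field `W₁` with the three (K-DE) reads on `□_k` at radius `s₀`, `Lᵏs₀ ≤ σ`, any tower `κf` of `W₁`: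
  the (D)(E)(τ) blocks + the seven windows at `τ := ‖th‖` (the body of `hTorus` at a general `W₁`; the k ≥ 2 composer feeds ✓`topReads_of_datum`'s reads).
* §3 ★★★`hTorus_base_of_windows` — THE SOCKET TEXT VERBATIM (✓`baseData_of_sockets`' binder `hTorus`, HOME `ym-ust-19200-w7/…BaseDataOfSockets.w7g5.lean` :135–:182), from
  the member's `ha`∕`hroomW`, `0 ≤ s`, and the (N05-WINDOWS) letters in the currency of ✓`HalvingHSupURhoWindowsRho3.exists_topCall_constants_of_rhoWindow₃` (4)–(5):
  `σ` with `s ≤ L^{−k}·σ` (read radius), `δ = 8(d+2)L·σ`, `ω = dLα₄∕2`, `τ₀ = 16m₀σ` (defining equations), `8·3800·((d+2)L)²·σ ≤ 1`, `32m₀σ ≤ 1`, `d(M′+ρ′) ≤ m₀`,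
  `160(α₄ + δ + 11ω) ≤ ¼`, the (E)-floors `640(α₄+δ+5ω)ω ≤ Cb`, `10240·dL·(α₄+δ+11ω) ≤ Cl`, and the seven top windows `∀ τ ∈ [0, τ₀]`.  Inside: §1 ⇒ reads at
  `s₀ := L^{−k}σ`; ✓`HalvingHSiteTorusBlocks` §1–§2 ⇒ territory, combs, lengths; (K-DE) ✓`P1FlatCoreTopBlocksAtMember` ⇒ (D)(E)(τ) with `‖th‖ ≤ 16m₀σ = τ₀` ⇒ the windows at `τ := ‖th‖`.
HONEST SCOPE.  By-name composition + window bookkeeping; nothing of [Balaban1985RegularSpaces] Prop. 5 ∕ Sect. E ∕ Theorem 4, `core′`, `hMember` or the stub is proved here.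

References: T. Bałaban, CMP **99** (1985) 75–102 [Balaban1985RegularSpaces] (p.98, (1.131) p.99, Sect. E (1.91)–(1.92) p.98, (1.111)–(1.125) pp.95–97); CMP **98** (1985)
17–51 [Balaban1985Averaging] (pp.24–25, (110) p.34); CMP **102** (1985) 277–309 [Balaban1985Variational] ((152) p.301).
-/

set_option autoImplicit false

noncomputable section

open scoped BigOperators Matrix.Norms.L2Operator
open NormedSpace

namespace Summit.QuantumFields.YangMills.Theorems.HalvingHSiteTorusSocketBase

open Literature.MathematicalPhysics.QuantumFieldTheory.Balaban1983to89
open Literature.MathematicalPhysics.QuantumFieldTheory.Balaban1983to89.T3ContinuumYM3Torus (T3Family)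
open T4Continuum (walk)
open MatrixLog (mlog)
open B5Eq118OneStroke (iterBlockOf)
open B7Prop1Explicit (e treeWord l1)
open B7Prop1Explicit renaming Site → LSite
open B7Prop1Local (InBox)
open B7Eq92Concrete (mgauge)
open B8Ineq130 (tlo thi)
open B8Eq131Cubes (cube gs tLo tHi tcube cube_anti cube_subset_tcube)
open B8Eq131CubesAdmissible (add_mem_cube_of_mem_succ)
open B8CubeMemberZd (cubeLamS)
open B8Eq1117Concrete (XSpace)
open B8Prop5ContractionKLevel (Mc Kc)
open B8SpecialUnitaryTrace (trCLM)
open B10Eq27TorusAxialLog (transl rel pull unitsField toUField suIncl gaugeActT gaugeActT_apply axialT)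
open B15Eq112TorusCover (lift cover)
open Node00 (coverAt)
open LatticeFieldCalculus (siteAvgIter)
open Summit.QuantumFields.YangMills.Theorems (FlatMinimizerH.le_T3)
open Summit.QuantumFields.YangMills.Theorems.Prop8ChartDoubleBar (dbarIterU vframeU)
open Summit.QuantumFields.YangMills.Theorems.P1FlatCoreCubeInclusion (transl_zero_eq_cover cover_lift_add_rel)
open Summit.QuantumFields.YangMills.Theorems.HalvingP1FlatCoreSupplierGaugeDescent (hg_of_datum)
open Summit.QuantumFields.YangMills.Theorems.HalvingCompetitorMapFibre (su2_toUnits)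
open Summit.QuantumFields.YangMills.Theorems.HalvingCompetitorMapFramesSU2 (su2_pred_mul su2_pred_inv)
open Summit.QuantumFields.YangMills.Theorems.HalvingHSiteTopKnit (gaugeActT_descent_eq_of_mgauge_cube)
open Summit.QuantumFields.YangMills.Theorems.P1FlatCoreTopBlocksAtMember
  (haxT_of_reads topTarget_of_reads hTop121_of_reads hTop125_of_reads hTopReal_of_reads hTopTrace_of_reads)
open Summit.QuantumFields.YangMills.Theorems.HalvingHSiteTorusBlocks
  (rep_mem_cube_top_of_mem coverAt_mem_territory walk_treeWord_subset_territory l1_rel_coverAt_le)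

variable {F : T3Family} {n K : ℕ}

/-! ## §1 The reads of the charted iterate `(U♯)^{ĝJ}` on the top cube from J3's fine near-`1` on □̃ (k-generic, `u₁ := 1`) -/

/-- ★ **THE READS FROM FINE NEAR-`1` (chart-free twin of ✓`topReads_of_datum`)**: at level `k := K − n ≥ 1`, if the pre-gauged field `U′ := pull (U^{gJ})♯ 0` obeys
`‖U′ x ν − 1‖ < s` for every fine bond `⟨x, x + e_ν⟩` of the tilde cube □̃ (`tlo L (tLo a ρ′) k ≤ x`, `x + e_ν ≤ thi L (tHi a M′ ρ′) k` — J3's row (d) at depth `k`),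
then for every torus bond `b` whose window representative `lift x₀ + rel x₀ b₋` lies in `□_k`:  `‖(U♯)^{ĝJ} b − 1‖ ≤ s`, `(U♯)^{ĝJ} b ∈ U(2)`, `det = 1`
(`ĝJ := (1 ∘ rep)⁻¹·(toUnits ∘ suIncl ∘ gJ)`; `□_k, □_k + e_ν ⊆ □₀ ∩ □̃`, the descent identity at `u₁ := 1`). [cite: Balaban1985RegularSpaces, (1.36) p.82, p.98, (1.131) p.99; Balaban1985Variational, (152) p.301] -/
theorem topReads_of_near (hnK : n < K) (x₀ : Site (F.P K) 0) {a : LSite (F.P K).d} {M' ρ' : ℕ} (hρ'1 : 1 ≤ ρ')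
    (ha : ∀ ν, a ν ≤ ((iterBlockOf (K - n) x₀ ν).val : ℤ) ∧ ((iterBlockOf (K - n) x₀ ν).val : ℤ) ≤ a ν + M' - 1)
    (hroomW : 2 * ((F.P K).L ^ (K - n) * (M' + 1) + ρ' * gs (F.P K).L (K - n)) ≤ (F.P K).sitesPerDir 0)
    (U : GaugeField (F.P K) 0 (Matrix.specialUnitaryGroup (Fin 2) ℂ)) (gJ : GaugeTransf (F.P K) 0 (Matrix.specialUnitaryGroup (Fin 2) ℂ)) {s : ℝ}
    (hfine : ∀ (x : LSite (F.P K).d) (ν : Fin (F.P K).d), tlo (F.P K).L (tLo a ρ') (K - n) ≤ x → x + e ν ≤ thi (F.P K).L (tHi a M' ρ') (K - n) →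
      ‖(((pull (unitsField (toUField (GaugeField.gaugeAct gJ U))) 0) x ν : (Matrix (Fin 2) (Fin 2) ℂ)ˣ) : (Matrix (Fin 2) (Fin 2) ℂ)) - 1‖ < s) :
    ∀ b : PBond (F.P K) 0, lift (F.P K) x₀ + rel x₀ b.src ∈ cube (F.P K).L a M' ρ' (K - n) (K - n) →
      ‖((gaugeActT (fun s => ((1 : LSite (F.P K).d → (Matrix (Fin 2) (Fin 2) ℂ)ˣ) (lift (F.P K) x₀ + rel x₀ s))⁻¹ * Unitary.toUnits (suIncl (gJ s)) :
          GaugeTransf (F.P K) 0 (Matrix (Fin 2) (Fin 2) ℂ)ˣ) (unitsField (toUField U)) b : (Matrix (Fin 2) (Fin 2) ℂ)ˣ) : Matrix (Fin 2) (Fin 2) ℂ) - 1‖ ≤ s ∧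
      ((gaugeActT (fun s => ((1 : LSite (F.P K).d → (Matrix (Fin 2) (Fin 2) ℂ)ˣ) (lift (F.P K) x₀ + rel x₀ s))⁻¹ * Unitary.toUnits (suIncl (gJ s)) :
          GaugeTransf (F.P K) 0 (Matrix (Fin 2) (Fin 2) ℂ)ˣ) (unitsField (toUField U)) b : (Matrix (Fin 2) (Fin 2) ℂ)ˣ) : Matrix (Fin 2) (Fin 2) ℂ) ∈
        Matrix.unitaryGroup (Fin 2) ℂ ∧
      ((gaugeActT (fun s => ((1 : LSite (F.P K).d → (Matrix (Fin 2) (Fin 2) ℂ)ˣ) (lift (F.P K) x₀ + rel x₀ s))⁻¹ * Unitary.toUnits (suIncl (gJ s)) :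
          GaugeTransf (F.P K) 0 (Matrix (Fin 2) (Fin 2) ℂ)ˣ) (unitsField (toUField U)) b : (Matrix (Fin 2) (Fin 2) ℂ)ˣ) : Matrix (Fin 2) (Fin 2) ℂ).det = 1 := by
  intro b hzk
  have hL2 : 2 ≤ (F.P K).L := (F.P K).hL.2
  have hk1 : 1 ≤ K - n := by omega
  set z : LSite (F.P K).d := lift (F.P K) x₀ + rel x₀ b.src with hzdef
  have hsrc : transl (0 : Site (F.P K) 0) z = b.src := by rw [transl_zero_eq_cover, hzdef, cover_lift_add_rel]
  have hb : b = ⟨transl (0 : Site (F.P K) 0) z, b.dir⟩ := by rw [hsrc]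
  -- both bond ends lie in `□₀`, and the bond lies in the tilde cube
  have hz0 : z ∈ cube (F.P K).L a M' ρ' (K - n) 0 := cube_anti (Nat.zero_le _) le_rfl hzk
  have hkk : K - n = (K - n - 1) + 1 := by omega
  have hzν1 : z + e b.dir ∈ cube (F.P K).L a M' ρ' (K - n) (K - n - 1) := by
    refine add_mem_cube_of_mem_succ (by omega) (hkk ▸ hzk) fun i => ?_
    rw [B7Prop1Explicit.e_apply]
    have h1 : (1 : ℤ) ≤ ((ρ' * (F.P K).L ^ (K - n - 1) : ℕ) : ℤ) := by
      have : 1 ≤ ρ' * (F.P K).L ^ (K - n - 1) := Nat.one_le_iff_ne_zero.2 (Nat.mul_ne_zero (by omega) (pow_ne_zero _ (F.P K).L_pos.ne'))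
      exact_mod_cast this
    split_ifs <;> simp only [abs_one, abs_zero] <;> linarith
  have hzν : z + e b.dir ∈ cube (F.P K).L a M' ρ' (K - n) 0 := cube_anti (Nat.zero_le _) (by omega) hzν1
  have hzt : z ∈ tcube (F.P K).L a M' ρ' (K - n) := cube_subset_tcube hL2 hρ'1 le_rfl hzk
  have hzνt : z + e b.dir ∈ tcube (F.P K).L a M' ρ' (K - n) := cube_subset_tcube hL2 hρ'1 (by omega) hzν1
  -- the descent identity at `u₁ := 1`
  have hW : mgauge (1 : LSite (F.P K).d → Fin (F.P K).d → (Matrix (Fin 2) (Fin 2) ℂ)ˣ) (1 : LSite (F.P K).d → (Matrix (Fin 2) (Fin 2) ℂ)ˣ)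
      (pull (unitsField (toUField (GaugeField.gaugeAct gJ U))) 0) = pull (unitsField (toUField (GaugeField.gaugeAct gJ U))) 0 := by
    funext x κ
    simp [mgauge]
  have hid := gaugeActT_descent_eq_of_mgauge_cube x₀ ha hroomW U gJ (1 : LSite (F.P K).d → (Matrix (Fin 2) (Fin 2) ℂ)ˣ) _ hW hz0 b.dir hzν
  refine ⟨?_, ?_⟩
  · rw [hb, hid]
    exact (hfine z b.dir (fun i => (hzt i).1) (fun i => (hzνt i).2)).le
  · have hg := hg_of_datum x₀ gJ (1 : LSite (F.P K).d → (Matrix (Fin 2) (Fin 2) ℂ)ˣ) fun z => by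
      rw [Pi.one_apply, Units.val_one]; exact Submonoid.one_mem _
    rw [gaugeActT_apply]
    exact su2_pred_mul _ _ (su2_pred_mul _ _ (Matrix.mem_specialUnitaryGroup_iff.1 (hg b.src)) (su2_toUnits U b))
      (su2_pred_inv _ (Matrix.mem_specialUnitaryGroup_iff.1 (hg b.tgt)))

/-! ## §2 The torus package for ANY field near `1` on the reads, in the window letters (k-generic; both FULL composers) -/

/-- ★★★ **THE TORUS PACKAGE FROM THE READS AND THE WINDOW LETTERS** (k-generic, any torus field `W₁`): if `W₁` is within `s₀` of `1`, unitary and of determinant one on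
every fine bond whose window representative lies in `□_k` (the three (K-DE) reads — ✓`topReads_of_datum` for the charted iterate, §1 for the `u₁ := 1` field), `Lᵏ·s₀ ≤ σ`,
and the (N05-WINDOWS) letters of ✓`exists_topCall_constants_of_rhoWindow₃` (3)–(5) hold (`δ ω τ₀` by their defining equations, `8·3800((d+2)L)²σ ≤ 1`, `32m₀σ ≤ 1`,
`d(M′+ρ′) ≤ m₀`, `160(α₄+δ+11ω) ≤ ¼`, the (E)-floors of `Cb`∕`Cl`, the seven top windows `∀ τ ∈ [0, τ₀]`), then for every tower `κf` of `W₁` with F3's recursion∕bottom: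
the blocks (D)(E)(τ) of the top-step call AND its seven windows at `τ := ‖th‖` — the body of ✓`baseData_of_sockets`' `hTorus` at a general `W₁`
((K-DE) ✓`P1FlatCoreTopBlocksAtMember` on the territory∕combs of ✓`HalvingHSiteTorusBlocks`; `‖th‖ ≤ 16m₀Lᵏs₀ ≤ τ₀`).
[cite: Balaban1985RegularSpaces, Sect. E (1.91)-(1.92) p.98, (1.111)-(1.125) pp.95-97, (1.131) p.99; Balaban1985Averaging, pp.24-25, (110) p.34] -/
theorem torusPackage_of_reads (x₀ : Site (F.P K) 0) {a : LSite (F.P K).d} {M' ρ' : ℕ} (hρ'1 : 1 ≤ ρ')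
    (ha : ∀ ν, a ν ≤ ((iterBlockOf (K - n) x₀ ν).val : ℤ) ∧ ((iterBlockOf (K - n) x₀ ν).val : ℤ) ≤ a ν + M' - 1)
    (hroomW : 2 * ((F.P K).L ^ (K - n) * (M' + 1) + ρ' * gs (F.P K).L (K - n)) ≤ (F.P K).sitesPerDir 0)
    (W₁ : GaugeField (F.P K) 0 (Matrix (Fin 2) (Fin 2) ℂ)ˣ) {s₀ : ℝ} (hs₀ : 0 ≤ s₀)
    (hreads : ∀ b : PBond (F.P K) 0, lift (F.P K) x₀ + rel x₀ b.src ∈ cube (F.P K).L a M' ρ' (K - n) (K - n) →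
      ‖((W₁ b : (Matrix (Fin 2) (Fin 2) ℂ)ˣ) : Matrix (Fin 2) (Fin 2) ℂ) - 1‖ ≤ s₀ ∧
      ((W₁ b : (Matrix (Fin 2) (Fin 2) ℂ)ˣ) : Matrix (Fin 2) (Fin 2) ℂ) ∈ Matrix.unitaryGroup (Fin 2) ℂ ∧
      ((W₁ b : (Matrix (Fin 2) (Fin 2) ℂ)ˣ) : Matrix (Fin 2) (Fin 2) ℂ).det = 1)
    -- the window letters (✓`exists_topCall_constants_of_rhoWindow₃` (3)–(5) currency)
    {α₄ cA cDA Cb Cl B₀'H B₂' BG BR σ δ ω τ₀ : ℝ} {m₀ : ℕ} (hα₄ : 0 < α₄)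
    (hs₀σ : ((F.P K).L : ℝ) ^ (K - n) * s₀ ≤ σ)
    (hδ : δ = 8 * ((((F.P K).d + 2) * (F.P K).L : ℕ) : ℝ) * σ) (hω : ω = ((F.P K).d : ℝ) * (F.P K).L * α₄ / 2) (hτ₀ : τ₀ = 16 * m₀ * σ)
    (hbudget : 8 * 3800 * ((((F.P K).d + 2) * (F.P K).L : ℕ) : ℝ) ^ 2 * σ ≤ 1) (hm : 32 * (m₀ : ℝ) * σ ≤ 1)
    (hm₀ : (F.P K).d * (M' + ρ') ≤ m₀) (hr : 160 * (α₄ + δ + 11 * ω) ≤ 1 / 4)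
    (hCb₀ : 640 * (α₄ + δ + 5 * ω) * ω ≤ Cb) (hCl₀ : 10240 * (((F.P K).d : ℝ) * (F.P K).L) * (α₄ + δ + 11 * ω) ≤ Cl)
    (hwin : ∀ τ : ℝ, 0 ≤ τ → τ ≤ τ₀ →
      B₀'H * τ < α₄ / 4 ∧ α₄ / 4 + B₀'H * (Cb + τ) ≤ 1 / 24 ∧ α₄ / 4 + B₀'H * (Cb + τ) ≤ 1 / 140 ∧
      10 * (α₄ / 4 + B₀'H * (Cb + τ)) * BR ≤ 1 / 2 ∧ B₀'H * (Cb + τ) ≤ 3 * α₄ / 4 ∧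
      BG * Mc (F.P K).d BR (α₄ / 4 + B₀'H * (Cb + τ)) cA (B₂' * (Cb + τ)) cDA ≤ α₄ / 4 ∧
      BG * Kc (F.P K).d BR (α₄ / 4 + B₀'H * (Cb + τ)) cA (B₂' * (Cb + τ)) cDA (B₂' * (2 * Cl)) (1 + B₀'H * (2 * Cl)) (1 + B₀'H * (2 * Cl))
        ≤ 1 / 2)
    -- ANY effective-gauge tower of `W₁` with F3's recursion and bottom
    (κf : (Site (F.P K) 0 → Matrix (Fin 2) (Fin 2) ℂ) → (i : ℕ) → GaugeTransf (F.P K) i (Matrix (Fin 2) (Fin 2) ℂ)ˣ)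
    (hκs : ∀ (m : Site (F.P K) 0 → Matrix (Fin 2) (Fin 2) ℂ) (i : ℕ) (y : Site (F.P K) (i + 1)),
      κf m (i + 1) y = (vframeU (gaugeActT (κf m i) (dbarIterU i W₁)) y)⁻¹ * κf m i (emb y) * vframeU (dbarIterU i W₁) y)
    (hκ0 : ∀ (m : Site (F.P K) 0 → Matrix (Fin 2) (Fin 2) ℂ) (x : Site (F.P K) 0),
      ((κf m 0 x : (Matrix (Fin 2) (Fin 2) ℂ)ˣ) : Matrix (Fin 2) (Fin 2) ℂ) = exp (m x)) :
    ∃ th : XSpace (F.P K).d (K - n) (Matrix (Fin 2) (Fin 2) ℂ),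
        B₀'H * ‖th‖ < α₄ / 4 ∧ (∀ p, star (th p) = -th p) ∧
        (∀ yc ∈ (cubeLamS (F.P K).L a M' ρ' (K - n) (K - n)) (K - n), th (⟨K - n, Nat.lt_succ_self (K - n)⟩, yc) =
          mlog ((axialT (dbarIterU (K - n) W₁) (iterBlockOf (K - n) x₀) (coverAt (F.P K) (K - n) yc) : (Matrix (Fin 2) (Fin 2) ℂ)ˣ) : (Matrix (Fin 2) (Fin 2) ℂ))) ∧
        (∀ (j : ℕ) (hj : j < K - n) (y : LSite (F.P K).d), y ∈ (cubeLamS (F.P K).L a M' ρ' (K - n) (K - n)) j → th (⟨j, Nat.lt_succ_of_lt hj⟩, y) = 0) ∧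
        (∀ yc ∈ (cubeLamS (F.P K).L a M' ρ' (K - n) (K - n)) (K - n), ‖((axialT (dbarIterU (K - n) W₁) (iterBlockOf (K - n) x₀) (coverAt (F.P K) (K - n) yc) : (Matrix (Fin 2) (Fin 2) ℂ)ˣ) : (Matrix (Fin 2) (Fin 2) ℂ)) - 1‖ < 1) ∧
        (∀ p, trCLM (Fin 2) (th p) = 0) ∧
        (α₄ / 4 + B₀'H * (Cb + ‖th‖) ≤ 1 / 24) ∧ (α₄ / 4 + B₀'H * (Cb + ‖th‖) ≤ 1 / 140) ∧
        (10 * (α₄ / 4 + B₀'H * (Cb + ‖th‖)) * BR ≤ 1 / 2) ∧ (B₀'H * (Cb + ‖th‖) ≤ 3 * α₄ / 4) ∧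
        (BG * Mc (F.P K).d BR (α₄ / 4 + B₀'H * (Cb + ‖th‖)) cA (B₂' * (Cb + ‖th‖)) cDA ≤ α₄ / 4) ∧
        (BG * Kc (F.P K).d BR (α₄ / 4 + B₀'H * (Cb + ‖th‖)) cA (B₂' * (Cb + ‖th‖)) cDA (B₂' * (2 * Cl)) (1 + B₀'H * (2 * Cl)) (1 + B₀'H * (2 * Cl)) ≤ 1 / 2) ∧
        (∀ yc ∈ (cubeLamS (F.P K).L a M' ρ' (K - n) (K - n)) (K - n), ∀ l₀ : Site (F.P K) 0 → (Matrix (Fin 2) (Fin 2) ℂ),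
          (∀ x : LSite (F.P K).d, InBox (tlo (F.P K).L yc (K - n)) (thi (F.P K).L yc (K - n)) x → ‖l₀ (cover (F.P K) x)‖ ≤ α₄) →
          (∀ (x : LSite (F.P K).d) (κ : Fin (F.P K).d), InBox (tlo (F.P K).L yc (K - n)) (thi (F.P K).L yc (K - n)) x →
            InBox (tlo (F.P K).L yc (K - n)) (thi (F.P K).L yc (K - n)) (x + e κ) → ‖l₀ (cover (F.P K) (x + e κ)) - l₀ (cover (F.P K) x)‖ ≤ α₄ * (((F.P K).L : ℝ) ^ (K - n))⁻¹) →
          exp (mlog ((κf l₀ (K - n) (coverAt (F.P K) (K - n) yc) : (Matrix (Fin 2) (Fin 2) ℂ)ˣ) : (Matrix (Fin 2) (Fin 2) ℂ))) = ((κf l₀ (K - n) (coverAt (F.P K) (K - n) yc) : (Matrix (Fin 2) (Fin 2) ℂ)ˣ) : (Matrix (Fin 2) (Fin 2) ℂ)) ∧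
            ‖mlog ((κf l₀ (K - n) (coverAt (F.P K) (K - n) yc) : (Matrix (Fin 2) (Fin 2) ℂ)ˣ) : (Matrix (Fin 2) (Fin 2) ℂ)) - siteAvgIter (K - n) l₀ (coverAt (F.P K) (K - n) yc)‖ ≤ Cb) ∧
        (∀ yc ∈ (cubeLamS (F.P K).L a M' ρ' (K - n) (K - n)) (K - n), ∀ (l₁ l₂ : Site (F.P K) 0 → (Matrix (Fin 2) (Fin 2) ℂ)) (r : ℝ), 0 ≤ r →
          (∀ x : LSite (F.P K).d, InBox (tlo (F.P K).L yc (K - n)) (thi (F.P K).L yc (K - n)) x → ‖l₁ (cover (F.P K) x)‖ ≤ α₄) →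
          (∀ (x : LSite (F.P K).d) (κ : Fin (F.P K).d), InBox (tlo (F.P K).L yc (K - n)) (thi (F.P K).L yc (K - n)) x →
            InBox (tlo (F.P K).L yc (K - n)) (thi (F.P K).L yc (K - n)) (x + e κ) → ‖l₁ (cover (F.P K) (x + e κ)) - l₁ (cover (F.P K) x)‖ ≤ α₄ * (((F.P K).L : ℝ) ^ (K - n))⁻¹) →
          (∀ x : LSite (F.P K).d, InBox (tlo (F.P K).L yc (K - n)) (thi (F.P K).L yc (K - n)) x → ‖l₂ (cover (F.P K) x)‖ ≤ α₄) →
          (∀ (x : LSite (F.P K).d) (κ : Fin (F.P K).d), InBox (tlo (F.P K).L yc (K - n)) (thi (F.P K).L yc (K - n)) x →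
            InBox (tlo (F.P K).L yc (K - n)) (thi (F.P K).L yc (K - n)) (x + e κ) → ‖l₂ (cover (F.P K) (x + e κ)) - l₂ (cover (F.P K) x)‖ ≤ α₄ * (((F.P K).L : ℝ) ^ (K - n))⁻¹) →
          (∀ x : LSite (F.P K).d, InBox (tlo (F.P K).L yc (K - n)) (thi (F.P K).L yc (K - n)) x → ‖l₁ (cover (F.P K) x) - l₂ (cover (F.P K) x)‖ ≤ r) →
          (∀ (x : LSite (F.P K).d) (κ : Fin (F.P K).d), InBox (tlo (F.P K).L yc (K - n)) (thi (F.P K).L yc (K - n)) x →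
            InBox (tlo (F.P K).L yc (K - n)) (thi (F.P K).L yc (K - n)) (x + e κ) →
            ‖(l₁ (cover (F.P K) (x + e κ)) - l₂ (cover (F.P K) (x + e κ))) - (l₁ (cover (F.P K) x) - l₂ (cover (F.P K) x))‖ ≤ r * (((F.P K).L : ℝ) ^ (K - n))⁻¹) →
          ‖(mlog ((κf l₁ (K - n) (coverAt (F.P K) (K - n) yc) : (Matrix (Fin 2) (Fin 2) ℂ)ˣ) : (Matrix (Fin 2) (Fin 2) ℂ)) - siteAvgIter (K - n) l₁ (coverAt (F.P K) (K - n) yc)) -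
              (mlog ((κf l₂ (K - n) (coverAt (F.P K) (K - n) yc) : (Matrix (Fin 2) (Fin 2) ℂ)ˣ) : (Matrix (Fin 2) (Fin 2) ℂ)) - siteAvgIter (K - n) l₂ (coverAt (F.P K) (K - n) yc))‖ ≤ Cl * r) ∧
        (∀ yc ∈ (cubeLamS (F.P K).L a M' ρ' (K - n) (K - n)) (K - n), ∀ l₀ : Site (F.P K) 0 → (Matrix (Fin 2) (Fin 2) ℂ),
          (∀ x : LSite (F.P K).d, InBox (tlo (F.P K).L yc (K - n)) (thi (F.P K).L yc (K - n)) x → ‖l₀ (cover (F.P K) x)‖ ≤ α₄) →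
          (∀ (x : LSite (F.P K).d) (κ : Fin (F.P K).d), InBox (tlo (F.P K).L yc (K - n)) (thi (F.P K).L yc (K - n)) x →
            InBox (tlo (F.P K).L yc (K - n)) (thi (F.P K).L yc (K - n)) (x + e κ) → ‖l₀ (cover (F.P K) (x + e κ)) - l₀ (cover (F.P K) x)‖ ≤ α₄ * (((F.P K).L : ℝ) ^ (K - n))⁻¹) →
          mlog ((κf (fun s => -star (l₀ s)) (K - n) (coverAt (F.P K) (K - n) yc) : (Matrix (Fin 2) (Fin 2) ℂ)ˣ) : (Matrix (Fin 2) (Fin 2) ℂ)) - siteAvgIter (K - n) (fun s => -star (l₀ s)) (coverAt (F.P K) (K - n) yc) =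
            -star (mlog ((κf l₀ (K - n) (coverAt (F.P K) (K - n) yc) : (Matrix (Fin 2) (Fin 2) ℂ)ˣ) : (Matrix (Fin 2) (Fin 2) ℂ)) - siteAvgIter (K - n) l₀ (coverAt (F.P K) (K - n) yc))) ∧
        (∀ yc ∈ (cubeLamS (F.P K).L a M' ρ' (K - n) (K - n)) (K - n), ∀ l₀ : Site (F.P K) 0 → (Matrix (Fin 2) (Fin 2) ℂ), (∀ s, trCLM (Fin 2) (l₀ s) = 0) →
          (∀ x : LSite (F.P K).d, InBox (tlo (F.P K).L yc (K - n)) (thi (F.P K).L yc (K - n)) x → ‖l₀ (cover (F.P K) x)‖ ≤ α₄) →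
          (∀ (x : LSite (F.P K).d) (κ : Fin (F.P K).d), InBox (tlo (F.P K).L yc (K - n)) (thi (F.P K).L yc (K - n)) x →
            InBox (tlo (F.P K).L yc (K - n)) (thi (F.P K).L yc (K - n)) (x + e κ) → ‖l₀ (cover (F.P K) (x + e κ)) - l₀ (cover (F.P K) x)‖ ≤ α₄ * (((F.P K).L : ℝ) ^ (K - n))⁻¹) →
          trCLM (Fin 2) (mlog ((κf l₀ (K - n) (coverAt (F.P K) (K - n) yc) : (Matrix (Fin 2) (Fin 2) ℂ)ˣ) : (Matrix (Fin 2) (Fin 2) ℂ)) - siteAvgIter (K - n) l₀ (coverAt (F.P K) (K - n) yc)) = 0) := by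
  have hk : K - n ≤ (F.P K).m + (F.P K).K := FlatMinimizerH.le_T3 F n K
  have hLk : (0 : ℝ) < ((F.P K).L : ℝ) ^ (K - n) := pow_pos (by exact_mod_cast (F.P K).L_pos) _
  have hX0 : (0 : ℝ) ≤ ((((F.P K).d + 2) * (F.P K).L : ℕ) : ℝ) := Nat.cast_nonneg _
  have hσ0 : 0 ≤ σ := le_trans (mul_nonneg hLk.le hs₀) hs₀σ
  have hω0 : 0 ≤ ω := by rw [hω]; positivity
  have hdL0 : (0 : ℝ) ≤ ((F.P K).d : ℝ) * (F.P K).L := by positivity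
  -- `δ′ := 8·(d+2)L·Lᵏs₀ ≤ δ`
  have hδ' : 8 * ((((F.P K).d + 2) * (F.P K).L : ℕ) : ℝ) * ((F.P K).L : ℝ) ^ (K - n) * s₀ ≤ δ := by
    rw [hδ, mul_assoc]; exact mul_le_mul_of_nonneg_left hs₀σ (by positivity)
  -- the reads on the territory (✓`HalvingHSiteTorusBlocks` §1)
  have hrd : ∀ b : PBond (F.P K) 0,
      iterBlockOf (K - n) b.src ∈ {B : Site (F.P K) (K - n) | ∃ yc ∈ cubeLamS (F.P K).L a M' ρ' (K - n) (K - n) (K - n), B = coverAt (F.P K) (K - n) yc} →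
      iterBlockOf (K - n) b.tgt ∈ {B : Site (F.P K) (K - n) | ∃ yc ∈ cubeLamS (F.P K).L a M' ρ' (K - n) (K - n) (K - n), B = coverAt (F.P K) (K - n) yc} →
      ‖((W₁ b : (Matrix (Fin 2) (Fin 2) ℂ)ˣ) : Matrix (Fin 2) (Fin 2) ℂ) - 1‖ ≤ s₀ ∧
      ((W₁ b : (Matrix (Fin 2) (Fin 2) ℂ)ˣ) : Matrix (Fin 2) (Fin 2) ℂ) ∈ Matrix.unitaryGroup (Fin 2) ℂ ∧
      ((W₁ b : (Matrix (Fin 2) (Fin 2) ℂ)ˣ) : Matrix (Fin 2) (Fin 2) ℂ).det = 1 :=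
    fun b hb _ => hreads b (rep_mem_cube_top_of_mem hk x₀ ha hroomW hb)
  have hW₁ := fun b hb ht => (hrd b hb ht).1
  have hWu := fun b hb ht => (hrd b hb ht).2.1
  have hdet := fun b hb ht => (hrd b hb ht).2.2
  -- the geometry of the territory (✓`HalvingHSiteTorusBlocks` §1–§2)
  have hΛT := coverAt_mem_territory (P := F.P K) (K - n) a M' ρ'
  have hcomb := walk_treeWord_subset_territory hk x₀ ha hroomW
  have hlen : ∀ yc ∈ cubeLamS (F.P K).L a M' ρ' (K - n) (K - n) (K - n),
      l1 (rel (iterBlockOf (K - n) x₀) (coverAt (F.P K) (K - n) yc)) ≤ m₀ :=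
    fun yc hyc => (l1_rel_coverAt_le hk x₀ ha hroomW yc hyc).trans hm₀
  have hd1 : 1 ≤ (F.P K).d := (F.P K).hd
  have hm₀1 : 1 ≤ m₀ := (Nat.one_le_iff_ne_zero.2 (Nat.mul_ne_zero (by omega) (by omega) : (F.P K).d * (M' + ρ') ≠ 0)).trans hm₀
  -- the (K-DE) windows in `s₀`-currency
  have hbudget' : 8 * 3800 * ((((F.P K).d + 2) * (F.P K).L : ℕ) : ℝ) ^ 2 * ((F.P K).L : ℝ) ^ (K - n) * s₀ ≤ 1 := by
    rw [mul_assoc]; exact (mul_le_mul_of_nonneg_left hs₀σ (by positivity)).trans hbudget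
  have hm' : 32 * (m₀ : ℝ) * (((F.P K).L : ℝ) ^ (K - n) * s₀) ≤ 1 := (mul_le_mul_of_nonneg_left hs₀σ (by positivity)).trans hm
  have hr' : 160 * (α₄ + 8 * ((((F.P K).d + 2) * (F.P K).L : ℕ) : ℝ) * ((F.P K).L : ℝ) ^ (K - n) * s₀ +
      11 * (((F.P K).d : ℝ) * (F.P K).L * α₄ / 2)) ≤ 1 / 4 := by
    rw [← hω]; exact le_trans (by linarith [hδ']) hr
  -- (D) the target and `haxT`
  obtain ⟨th, hth, hthk, hthlo, hthn, hthτ⟩ := topTarget_of_reads hk _ _ hs₀ hbudget' hW₁ hWu hdet (iterBlockOf (K - n) x₀)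
    (cubeLamS (F.P K).L a M' ρ' (K - n) (K - n) (K - n)) hcomb hm₀1 hlen hm'
  have haxT := haxT_of_reads hk _ _ hs₀ hbudget' hW₁ (iterBlockOf (K - n) x₀) (cubeLamS (F.P K).L a M' ρ' (K - n) (K - n) (K - n)) hcomb hm₀1 hlen hm'
  -- (E) the four top rows, floors weakened to the composer's `Cb`, `Cl`
  have h121 := hTop121_of_reads hk _ _ hs₀ hbudget' hW₁ κf hκs hκ0 _ hΛT hα₄.le hr'
  have h125 := hTop125_of_reads hk _ _ hs₀ hbudget' hW₁ κf hκs hκ0 _ hΛT hα₄ hr'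
  have hReal := hTopReal_of_reads hk _ _ hs₀ hbudget' hW₁ hWu κf hκs hκ0 _ hΛT hα₄.le hr'
  have hTrace := hTopTrace_of_reads hk _ _ hs₀ hbudget' hW₁ hdet κf hκs hκ0 _ hΛT hα₄.le hr'
  have hCb' : 640 * (α₄ + 8 * ((((F.P K).d + 2) * (F.P K).L : ℕ) : ℝ) * ((F.P K).L : ℝ) ^ (K - n) * s₀ + 5 * (((F.P K).d : ℝ) * (F.P K).L * α₄ / 2)) *
      (((F.P K).d : ℝ) * (F.P K).L * α₄ / 2) ≤ Cb := by
    rw [← hω]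
    exact le_trans (mul_le_mul_of_nonneg_right (mul_le_mul_of_nonneg_left (by linarith [hδ']) (by norm_num)) hω0) hCb₀
  have hCl' : 10240 * (((F.P K).d : ℝ) * (F.P K).L) *
      (α₄ + 8 * ((((F.P K).d + 2) * (F.P K).L : ℕ) : ℝ) * ((F.P K).L : ℝ) ^ (K - n) * s₀ + 11 * (((F.P K).d : ℝ) * (F.P K).L * α₄ / 2)) ≤ Cl := by
    rw [← hω]
    exact le_trans (mul_le_mul_of_nonneg_left (by linarith [hδ']) (by positivity)) hCl₀
  -- the seven top windows at `τ := ‖th‖ ≤ 16·m₀·Lᵏ·s₀ ≤ 16·m₀·σ = τ₀`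
  have hthτ₀ : ‖th‖ ≤ τ₀ := by
    rw [hτ₀]; exact hthn.trans (mul_le_mul_of_nonneg_left hs₀σ (by positivity))
  obtain ⟨hτ, ha₁', hb₁', hθ, hh₀', h103, h106⟩ := hwin ‖th‖ (norm_nonneg _) hthτ₀
  refine ⟨th, hτ, hth, hthk, fun j hj y _ => hthlo j hj y, haxT, hthτ, ha₁', hb₁', hθ, hh₀', h103, h106, ?_, ?_, hReal, hTrace⟩
  · intro yc hyc l₀ hb hg
    obtain ⟨h1, h2⟩ := h121 yc hyc l₀ hb hg
    exact ⟨h1, h2.trans hCb'⟩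
  · intro yc hyc l₁ l₂ r hr0 h1b h1g h2b h2g hmb hmg
    exact (h125 yc hyc l₁ l₂ r hr0 h1b h1g h2b h2g hmb hmg).trans (mul_le_mul_of_nonneg_right hCl' hr0)

/-! ## §3 The torus socket of the k = 1 composer, discharged -/

/-- ★★★ **THE TORUS SOCKET `hTorus` OF ✓`baseData_of_sockets`, INHABITED** (its text VERBATIM as the conclusion), from the member's corner row `ha` and no-wrap room
`hroomW`, `0 ≤ s ≤ L^{−k}σ` (J3's fine near-`1` radius against the read radius), and the (N05-WINDOWS) letters (§2's list): §1 ⇒ the reads of `(U♯)^{ĝJ}` at `s`, then §2.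
[cite: Balaban1985RegularSpaces, Sect. E (1.91)-(1.92) p.98, (1.111)-(1.125) pp.95-97, (1.131) p.99; Balaban1985Averaging, pp.24-25, (110) p.34] -/
theorem hTorus_base_of_windows (hnK : n < K) (x₀ : Site (F.P K) 0) {a : LSite (F.P K).d} {M' ρ' : ℕ} (hρ'1 : 1 ≤ ρ')
    (ha : ∀ ν, a ν ≤ ((iterBlockOf (K - n) x₀ ν).val : ℤ) ∧ ((iterBlockOf (K - n) x₀ ν).val : ℤ) ≤ a ν + M' - 1)
    (hroomW : 2 * ((F.P K).L ^ (K - n) * (M' + 1) + ρ' * gs (F.P K).L (K - n)) ≤ (F.P K).sitesPerDir 0)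
    (U : GaugeField (F.P K) 0 (Matrix.specialUnitaryGroup (Fin 2) ℂ)) {s : ℝ} (hs0 : 0 ≤ s)
    -- the window letters (✓`exists_topCall_constants_of_rhoWindow₃` (3)–(5) currency)
    {α₄ cA cDA Cb Cl B₀'H B₂' BG BR σ δ ω τ₀ : ℝ} {m₀ : ℕ} (hα₄ : 0 < α₄)
    (hsσ : s ≤ (((F.P K).L : ℝ) ^ (K - n))⁻¹ * σ)
    (hδ : δ = 8 * ((((F.P K).d + 2) * (F.P K).L : ℕ) : ℝ) * σ) (hω : ω = ((F.P K).d : ℝ) * (F.P K).L * α₄ / 2) (hτ₀ : τ₀ = 16 * m₀ * σ)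
    (hbudget : 8 * 3800 * ((((F.P K).d + 2) * (F.P K).L : ℕ) : ℝ) ^ 2 * σ ≤ 1) (hm : 32 * (m₀ : ℝ) * σ ≤ 1)
    (hm₀ : (F.P K).d * (M' + ρ') ≤ m₀) (hr : 160 * (α₄ + δ + 11 * ω) ≤ 1 / 4)
    (hCb₀ : 640 * (α₄ + δ + 5 * ω) * ω ≤ Cb) (hCl₀ : 10240 * (((F.P K).d : ℝ) * (F.P K).L) * (α₄ + δ + 11 * ω) ≤ Cl)
    (hwin : ∀ τ : ℝ, 0 ≤ τ → τ ≤ τ₀ →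
      B₀'H * τ < α₄ / 4 ∧ α₄ / 4 + B₀'H * (Cb + τ) ≤ 1 / 24 ∧ α₄ / 4 + B₀'H * (Cb + τ) ≤ 1 / 140 ∧
      10 * (α₄ / 4 + B₀'H * (Cb + τ)) * BR ≤ 1 / 2 ∧ B₀'H * (Cb + τ) ≤ 3 * α₄ / 4 ∧
      BG * Mc (F.P K).d BR (α₄ / 4 + B₀'H * (Cb + τ)) cA (B₂' * (Cb + τ)) cDA ≤ α₄ / 4 ∧
      BG * Kc (F.P K).d BR (α₄ / 4 + B₀'H * (Cb + τ)) cA (B₂' * (Cb + τ)) cDA (B₂' * (2 * Cl)) (1 + B₀'H * (2 * Cl)) (1 + B₀'H * (2 * Cl))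
        ≤ 1 / 2) :
    ∀ (gJ : GaugeTransf (F.P K) 0 (Matrix.specialUnitaryGroup (Fin 2) ℂ)),
      (∀ (x : LSite (F.P K).d) (ν : Fin (F.P K).d), tlo (F.P K).L (tLo a ρ') (K - n) ≤ x → x + e ν ≤ thi (F.P K).L (tHi a M' ρ') (K - n) →
        ‖(((pull (unitsField (toUField (GaugeField.gaugeAct gJ U))) 0) x ν : (Matrix (Fin 2) (Fin 2) ℂ)ˣ) : (Matrix (Fin 2) (Fin 2) ℂ)) - 1‖ < s) →
      ∀ (κf : (Site (F.P K) 0 → (Matrix (Fin 2) (Fin 2) ℂ)) → (i : ℕ) → GaugeTransf (F.P K) i (Matrix (Fin 2) (Fin 2) ℂ)ˣ),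
      (∀ (m : Site (F.P K) 0 → (Matrix (Fin 2) (Fin 2) ℂ)) (i : ℕ) (y : Site (F.P K) (i + 1)),
        κf m (i + 1) y = (vframeU (gaugeActT (κf m i) (dbarIterU i (gaugeActT (fun s => ((1 : LSite (F.P K).d → (Matrix (Fin 2) (Fin 2) ℂ)ˣ) (lift (F.P K) x₀ + rel x₀ s))⁻¹ * Unitary.toUnits (suIncl (gJ s)) : GaugeTransf (F.P K) 0 (Matrix (Fin 2) (Fin 2) ℂ)ˣ) (unitsField (toUField U))))) y)⁻¹ * κf m i (emb y) * vframeU (dbarIterU i (gaugeActT (fun s => ((1 : LSite (F.P K).d → (Matrix (Fin 2) (Fin 2) ℂ)ˣ) (lift (F.P K) x₀ + rel x₀ s))⁻¹ * Unitary.toUnits (suIncl (gJ s)) : GaugeTransf (F.P K) 0 (Matrix (Fin 2) (Fin 2) ℂ)ˣ) (unitsField (toUField U)))) y) →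
      (∀ (m : Site (F.P K) 0 → (Matrix (Fin 2) (Fin 2) ℂ)) (x : Site (F.P K) 0), ((κf m 0 x : (Matrix (Fin 2) (Fin 2) ℂ)ˣ) : (Matrix (Fin 2) (Fin 2) ℂ)) = exp (m x)) →
      ∃ th : XSpace (F.P K).d (K - n) (Matrix (Fin 2) (Fin 2) ℂ),
        B₀'H * ‖th‖ < α₄ / 4 ∧ (∀ p, star (th p) = -th p) ∧
        (∀ yc ∈ (cubeLamS (F.P K).L a M' ρ' (K - n) (K - n)) (K - n), th (⟨K - n, Nat.lt_succ_self (K - n)⟩, yc) =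
          mlog ((axialT (dbarIterU (K - n) (gaugeActT (fun s => ((1 : LSite (F.P K).d → (Matrix (Fin 2) (Fin 2) ℂ)ˣ) (lift (F.P K) x₀ + rel x₀ s))⁻¹ * Unitary.toUnits (suIncl (gJ s)) : GaugeTransf (F.P K) 0 (Matrix (Fin 2) (Fin 2) ℂ)ˣ) (unitsField (toUField U)))) (iterBlockOf (K - n) x₀) (coverAt (F.P K) (K - n) yc) : (Matrix (Fin 2) (Fin 2) ℂ)ˣ) : (Matrix (Fin 2) (Fin 2) ℂ))) ∧
        (∀ (j : ℕ) (hj : j < K - n) (y : LSite (F.P K).d), y ∈ (cubeLamS (F.P K).L a M' ρ' (K - n) (K - n)) j → th (⟨j, Nat.lt_succ_of_lt hj⟩, y) = 0) ∧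
        (∀ yc ∈ (cubeLamS (F.P K).L a M' ρ' (K - n) (K - n)) (K - n), ‖((axialT (dbarIterU (K - n) (gaugeActT (fun s => ((1 : LSite (F.P K).d → (Matrix (Fin 2) (Fin 2) ℂ)ˣ) (lift (F.P K) x₀ + rel x₀ s))⁻¹ * Unitary.toUnits (suIncl (gJ s)) : GaugeTransf (F.P K) 0 (Matrix (Fin 2) (Fin 2) ℂ)ˣ) (unitsField (toUField U)))) (iterBlockOf (K - n) x₀) (coverAt (F.P K) (K - n) yc) : (Matrix (Fin 2) (Fin 2) ℂ)ˣ) : (Matrix (Fin 2) (Fin 2) ℂ)) - 1‖ < 1) ∧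
        (∀ p, trCLM (Fin 2) (th p) = 0) ∧
        (α₄ / 4 + B₀'H * (Cb + ‖th‖) ≤ 1 / 24) ∧ (α₄ / 4 + B₀'H * (Cb + ‖th‖) ≤ 1 / 140) ∧
        (10 * (α₄ / 4 + B₀'H * (Cb + ‖th‖)) * BR ≤ 1 / 2) ∧ (B₀'H * (Cb + ‖th‖) ≤ 3 * α₄ / 4) ∧
        (BG * Mc (F.P K).d BR (α₄ / 4 + B₀'H * (Cb + ‖th‖)) cA (B₂' * (Cb + ‖th‖)) cDA ≤ α₄ / 4) ∧
        (BG * Kc (F.P K).d BR (α₄ / 4 + B₀'H * (Cb + ‖th‖)) cA (B₂' * (Cb + ‖th‖)) cDA (B₂' * (2 * Cl)) (1 + B₀'H * (2 * Cl)) (1 + B₀'H * (2 * Cl)) ≤ 1 / 2) ∧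
        (∀ yc ∈ (cubeLamS (F.P K).L a M' ρ' (K - n) (K - n)) (K - n), ∀ l₀ : Site (F.P K) 0 → (Matrix (Fin 2) (Fin 2) ℂ),
          (∀ x : LSite (F.P K).d, InBox (tlo (F.P K).L yc (K - n)) (thi (F.P K).L yc (K - n)) x → ‖l₀ (cover (F.P K) x)‖ ≤ α₄) →
          (∀ (x : LSite (F.P K).d) (κ : Fin (F.P K).d), InBox (tlo (F.P K).L yc (K - n)) (thi (F.P K).L yc (K - n)) x →
            InBox (tlo (F.P K).L yc (K - n)) (thi (F.P K).L yc (K - n)) (x + e κ) → ‖l₀ (cover (F.P K) (x + e κ)) - l₀ (cover (F.P K) x)‖ ≤ α₄ * (((F.P K).L : ℝ) ^ (K - n))⁻¹) →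
          exp (mlog ((κf l₀ (K - n) (coverAt (F.P K) (K - n) yc) : (Matrix (Fin 2) (Fin 2) ℂ)ˣ) : (Matrix (Fin 2) (Fin 2) ℂ))) = ((κf l₀ (K - n) (coverAt (F.P K) (K - n) yc) : (Matrix (Fin 2) (Fin 2) ℂ)ˣ) : (Matrix (Fin 2) (Fin 2) ℂ)) ∧
            ‖mlog ((κf l₀ (K - n) (coverAt (F.P K) (K - n) yc) : (Matrix (Fin 2) (Fin 2) ℂ)ˣ) : (Matrix (Fin 2) (Fin 2) ℂ)) - siteAvgIter (K - n) l₀ (coverAt (F.P K) (K - n) yc)‖ ≤ Cb) ∧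
        (∀ yc ∈ (cubeLamS (F.P K).L a M' ρ' (K - n) (K - n)) (K - n), ∀ (l₁ l₂ : Site (F.P K) 0 → (Matrix (Fin 2) (Fin 2) ℂ)) (r : ℝ), 0 ≤ r →
          (∀ x : LSite (F.P K).d, InBox (tlo (F.P K).L yc (K - n)) (thi (F.P K).L yc (K - n)) x → ‖l₁ (cover (F.P K) x)‖ ≤ α₄) →
          (∀ (x : LSite (F.P K).d) (κ : Fin (F.P K).d), InBox (tlo (F.P K).L yc (K - n)) (thi (F.P K).L yc (K - n)) x →
            InBox (tlo (F.P K).L yc (K - n)) (thi (F.P K).L yc (K - n)) (x + e κ) → ‖l₁ (cover (F.P K) (x + e κ)) - l₁ (cover (F.P K) x)‖ ≤ α₄ * (((F.P K).L : ℝ) ^ (K - n))⁻¹) →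
          (∀ x : LSite (F.P K).d, InBox (tlo (F.P K).L yc (K - n)) (thi (F.P K).L yc (K - n)) x → ‖l₂ (cover (F.P K) x)‖ ≤ α₄) →
          (∀ (x : LSite (F.P K).d) (κ : Fin (F.P K).d), InBox (tlo (F.P K).L yc (K - n)) (thi (F.P K).L yc (K - n)) x →
            InBox (tlo (F.P K).L yc (K - n)) (thi (F.P K).L yc (K - n)) (x + e κ) → ‖l₂ (cover (F.P K) (x + e κ)) - l₂ (cover (F.P K) x)‖ ≤ α₄ * (((F.P K).L : ℝ) ^ (K - n))⁻¹) →
          (∀ x : LSite (F.P K).d, InBox (tlo (F.P K).L yc (K - n)) (thi (F.P K).L yc (K - n)) x → ‖l₁ (cover (F.P K) x) - l₂ (cover (F.P K) x)‖ ≤ r) →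
          (∀ (x : LSite (F.P K).d) (κ : Fin (F.P K).d), InBox (tlo (F.P K).L yc (K - n)) (thi (F.P K).L yc (K - n)) x →
            InBox (tlo (F.P K).L yc (K - n)) (thi (F.P K).L yc (K - n)) (x + e κ) →
            ‖(l₁ (cover (F.P K) (x + e κ)) - l₂ (cover (F.P K) (x + e κ))) - (l₁ (cover (F.P K) x) - l₂ (cover (F.P K) x))‖ ≤ r * (((F.P K).L : ℝ) ^ (K - n))⁻¹) →
          ‖(mlog ((κf l₁ (K - n) (coverAt (F.P K) (K - n) yc) : (Matrix (Fin 2) (Fin 2) ℂ)ˣ) : (Matrix (Fin 2) (Fin 2) ℂ)) - siteAvgIter (K - n) l₁ (coverAt (F.P K) (K - n) yc)) -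
              (mlog ((κf l₂ (K - n) (coverAt (F.P K) (K - n) yc) : (Matrix (Fin 2) (Fin 2) ℂ)ˣ) : (Matrix (Fin 2) (Fin 2) ℂ)) - siteAvgIter (K - n) l₂ (coverAt (F.P K) (K - n) yc))‖ ≤ Cl * r) ∧
        (∀ yc ∈ (cubeLamS (F.P K).L a M' ρ' (K - n) (K - n)) (K - n), ∀ l₀ : Site (F.P K) 0 → (Matrix (Fin 2) (Fin 2) ℂ),
          (∀ x : LSite (F.P K).d, InBox (tlo (F.P K).L yc (K - n)) (thi (F.P K).L yc (K - n)) x → ‖l₀ (cover (F.P K) x)‖ ≤ α₄) →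
          (∀ (x : LSite (F.P K).d) (κ : Fin (F.P K).d), InBox (tlo (F.P K).L yc (K - n)) (thi (F.P K).L yc (K - n)) x →
            InBox (tlo (F.P K).L yc (K - n)) (thi (F.P K).L yc (K - n)) (x + e κ) → ‖l₀ (cover (F.P K) (x + e κ)) - l₀ (cover (F.P K) x)‖ ≤ α₄ * (((F.P K).L : ℝ) ^ (K - n))⁻¹) →
          mlog ((κf (fun s => -star (l₀ s)) (K - n) (coverAt (F.P K) (K - n) yc) : (Matrix (Fin 2) (Fin 2) ℂ)ˣ) : (Matrix (Fin 2) (Fin 2) ℂ)) - siteAvgIter (K - n) (fun s => -star (l₀ s)) (coverAt (F.P K) (K - n) yc) =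
            -star (mlog ((κf l₀ (K - n) (coverAt (F.P K) (K - n) yc) : (Matrix (Fin 2) (Fin 2) ℂ)ˣ) : (Matrix (Fin 2) (Fin 2) ℂ)) - siteAvgIter (K - n) l₀ (coverAt (F.P K) (K - n) yc))) ∧
        (∀ yc ∈ (cubeLamS (F.P K).L a M' ρ' (K - n) (K - n)) (K - n), ∀ l₀ : Site (F.P K) 0 → (Matrix (Fin 2) (Fin 2) ℂ), (∀ s, trCLM (Fin 2) (l₀ s) = 0) →
          (∀ x : LSite (F.P K).d, InBox (tlo (F.P K).L yc (K - n)) (thi (F.P K).L yc (K - n)) x → ‖l₀ (cover (F.P K) x)‖ ≤ α₄) →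
          (∀ (x : LSite (F.P K).d) (κ : Fin (F.P K).d), InBox (tlo (F.P K).L yc (K - n)) (thi (F.P K).L yc (K - n)) x →
            InBox (tlo (F.P K).L yc (K - n)) (thi (F.P K).L yc (K - n)) (x + e κ) → ‖l₀ (cover (F.P K) (x + e κ)) - l₀ (cover (F.P K) x)‖ ≤ α₄ * (((F.P K).L : ℝ) ^ (K - n))⁻¹) →
          trCLM (Fin 2) (mlog ((κf l₀ (K - n) (coverAt (F.P K) (K - n) yc) : (Matrix (Fin 2) (Fin 2) ℂ)ˣ) : (Matrix (Fin 2) (Fin 2) ℂ)) - siteAvgIter (K - n) l₀ (coverAt (F.P K) (K - n) yc)) = 0) := by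
  intro gJ hfine κf hκs hκ0
  have hLk : (0 : ℝ) < ((F.P K).L : ℝ) ^ (K - n) := pow_pos (by exact_mod_cast (F.P K).L_pos) _
  have hsσ' : ((F.P K).L : ℝ) ^ (K - n) * s ≤ σ := by
    have h := mul_le_mul_of_nonneg_left hsσ hLk.le
    rwa [← mul_assoc, mul_inv_cancel₀ hLk.ne', one_mul] at h
  exact torusPackage_of_reads x₀ hρ'1 ha hroomW _ hs0 (topReads_of_near hnK x₀ hρ'1 ha hroomW U gJ hfine) hα₄ hsσ' hδ hω hτ₀
    hbudget hm hm₀ hr hCb₀ hCl₀ hwin κf hκs hκ0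

end Summit.QuantumFields.YangMills.Theorems.HalvingHSiteTorusSocketBase

end
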